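import Literature.AlgebraicGeometry.Frobenioids.ArithmeticFrobenioidThm64ivFieldIso
import Literature.AlgebraicGeometry.Frobenioids.DivisorMonoidCategoryTheoreticityCor411ivHolds
import Literature.AlgebraicGeometry.Frobenioids.ArithmeticFrobenioidRationallyStandard
import Literature.AlgebraicGeometry.Frobenioids.MotivatingExamplesThm64ivBaseCompat
import HarnessLib

/-!
# Frobenioids I, Theorem 6.4 (iv), second clause, AT THE CONSTRUCTIONS — UNCONDITIONAL

Mochizuki, *The geometry of Frobenioids I: the general theory*, Kyushu J. Math. **62** (2008) 293–400, §6,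
Thm. 6.4 (iv) p. 115 l. 23–29: "If, moreover, there exists a finite extension `L₁ ⊆ F̃₁` of `F₁` which is Galois
over `ℚ`, then the corresponding [i.e., via the equivalence `D₁ ⥲ D₂` induced by `Ψ` — cf. (i); Corollary 4.11,
(ii)] finite extension `L₂ ⊆ F̃₂` of `F₂` is isomorphic to `L₁` in a fashion that is compatible with an isomorphism
`F₁ ⥲ F₂`" [cite: MochizukiFrdI2008, Thm. 6.4 (iv) p.115].

PROOF-ONLY file (cell abc-iut, `plan/L1/SUBDAG-FrdI-Thm64.md` §G, DATA-LEVEL composition row T64iv/L08; L1-lead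
R108 (4) row (G); seat abc-iut-L1-d7).  The last input of `Thm64iv_arith_of_cor411iv'`
(`ArithmeticFrobenioidThm64ivFieldIso.lean`) — the typed [FrdI] Cor. 4.11 (iv) for `Ψ` — is DISCHARGED at
`C_{K/F}` by `FrdI.cor411iv_ofFunctor_of_isOfFSMType` (`DivisorMonoidCategoryTheoreticityCor411ivHolds.lean`, abc-iut-L1-t14 / abc-iut-f-033; Cor. 4.11 (iv) for Frobenioids over
FSM-type bases with perf-factorial divisor monoids and `C₁` rational at THE birationalization — all PROVED for the
arithmetic Frobenioids: `arithFrobenioid_isFrobenioid`, `FinSubextCat.isOfFSMType`, `arith_objectwise_isPerfFactorial`,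
`arith_isRational_rsParams`).  Hence, for EVERY equivalence `Ψ : C_{K₁/F₁} ⥲ C_{K₂/F₂}` of the constructed
arithmetic Frobenioids (`K_i/F_i` finite Galois extensions of number fields):
* `Thm64iv_arith` — `Ψ^Base : D₁ ⥲ D₂` (an equivalence lying under `Ψ`), and for every `X = Spec L₁ ∈ Ob(D₁)` a
  bijection of finite places `V(L₁)^non ≃ V(L₂)^non`, `L₂ := (Ψ^Base X).L`, preserving norms and residue
  characteristics, with `L₁ ≅ L₂` whenever `L₁` is Galois over `ℚ`;
* `Thm64iv_arith_compat` — if `F₁` is Galois over `ℚ`, the isomorphism is compatible with an isomorphism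
  `F₁ ≅ F₂` (abc-iut-L1-d4's `Thm64iv_compat_of_transport_of_isGalois_base`, row T64iv/L07b in that case); for
  `F₁` not Galois over `ℚ` print's compatibility clause stays GAP-LEDGER G-L1t3-1 (not argued in print's proof).
The first clause "`deg(Ψ^rlf) = 1`" concerns THE degree datum of Thm. 6.4 (ii) and is abc-iut-L1-t3's schema
assembly (`Thm64iv_of_generatorReadings`); here `Ψ^Φ` preserving norms is its generator-level content.
No definitions, no named facts, no hypothesis beyond the data; nothing here bears on [IUTchIII] Cor. 3.12.
-/

noncomputable section

namespace Literature.AlgebraicGeometry.Frobenioids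

open CategoryTheory Opposite NumberField

section Arith

variable {F₁ : Type} [Field F₁] [NumberField F₁] {K₁ : Type} [Field K₁] [Algebra F₁ K₁] [IsGalois F₁ K₁]
variable {F₂ : Type} [Field F₂] [NumberField F₂] {K₂ : Type} [Field K₂] [Algebra F₂ K₂] [IsGalois F₂ K₂]

/-- **[FrdI] Cor. 4.11 (iv) AS TYPED holds for every equivalence of arithmetic Frobenioids** (abc-iut-L1-t14's
`FrdI.cor411iv_ofFunctor_of_isOfFSMType` at `C_{K/F}`: FSM-type bases, perf-factorial `Φ`, `C_{K₁/F₁}` rational at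
THE birationalization). [cite: MochizukiFrdI2008, Cor. 4.11 (iv) p.92] -/
theorem arith_cor411iv (Ψ : arithFrobenioid F₁ K₁ ≌ arithFrobenioid F₂ K₂) :
    PreFrobenioidData.Cor411iv
      (ModelFrobenioid.data (arithDivisorFunctor F₁ K₁) (unitsFunctor F₁ K₁) (divNatTrans F₁ K₁))
      (ModelFrobenioid.data (arithDivisorFunctor F₂ K₂) (unitsFunctor F₂ K₂) (divNatTrans F₂ K₂)) Ψ
      (PreFrobenioid.rsParams (arithFrobenioid_isFrobenioid F₁ K₁) fun a 𝔭 => PrimarySupp a 𝔭)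
      (PreFrobenioid.rsParams (arithFrobenioid_isFrobenioid F₂ K₂) fun a 𝔭 => PrimarySupp a 𝔭) :=
  FrdI.cor411iv_ofFunctor_of_isOfFSMType (arithFrobenioid_isFrobenioid F₁ K₁) (arithFrobenioid_isFrobenioid F₂ K₂)
    (FinSubextCat.isOfFSMType F₁ K₁) (FinSubextCat.isOfFSMType F₂ K₂)
    (arith_objectwise_isPerfFactorial F₁ K₁) (arith_objectwise_isPerfFactorial F₂ K₂)
    (arith_isRational_rsParams F₁ K₁) Ψ _ _

/-- **[FrdI] Thm. 6.4 (iv), second clause, AT THE CONSTRUCTIONS — UNCONDITIONAL**: for every equivalence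
`Ψ : C_{K₁/F₁} ⥲ C_{K₂/F₂}` of arithmetic Frobenioids there are `Ψ^Base : D₁ ⥤ D₂` (an equivalence) under `Ψ`
(`η : Base₂ ∘ Ψ ≅ Ψ^Base ∘ Base₁`) and, for every `X = Spec L₁`, a bijection `π_X` between the finite places of `L₁`
and of `L₂ := (Ψ^Base X).L` preserving NORMS and residue characteristics (generator ↦ generator under `Ψ^Φ`), and
`L₁ ≅ L₂` as fields whenever `L₁` is Galois over `ℚ`. [cite: MochizukiFrdI2008, Thm. 6.4 (iv) p.115] -/
theorem Thm64iv_arith (Ψ : arithFrobenioid F₁ K₁ ≌ arithFrobenioid F₂ K₂) :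
    ∃ (ΨBase : FinSubextCat F₁ K₁ ⥤ FinSubextCat F₂ K₂)
      (_ : Ψ.functor ⋙ (arithFrobenioidOps F₂ K₂).base ≅ (arithFrobenioidOps F₁ K₁).base ⋙ ΨBase)
      (π : ∀ X : FinSubextCat F₁ K₁, FinitePlace X.L ≃ FinitePlace (ΨBase.obj X).L),
      ΨBase.IsEquivalence ∧
      (∀ (X : FinSubextCat F₁ K₁) (w : FinitePlace X.L), logNorm (π X w) = logNorm w) ∧
      (∀ (X : FinSubextCat F₁ K₁) (w : FinitePlace X.L), residueChar (π X w) = residueChar w) ∧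
      ∀ X : FinSubextCat F₁ K₁, IsGalois ℚ X.L → Nonempty (X.L ≃+* (ΨBase.obj X).L) :=
  Thm64iv_arith_of_cor411iv' Ψ (arith_cor411iv Ψ)

/-- **[FrdI] Thm. 6.4 (iv), second clause WITH the compatibility with `F₁ ≅ F₂`, for `F₁` Galois over `ℚ`** —
unconditional at the constructions: the field isomorphisms of `Thm64iv_arith` are made compatible with an
isomorphism `F₁ ≅ F₂` by abc-iut-L1-d4's `Thm64iv_compat_of_transport_of_isGalois_base` (applied at `Spec F₁ = ⟨⊥⟩`
and at `X`).  For `F₁` not Galois over `ℚ` this compatibility is GAP-LEDGER G-L1t3-1 (print asserts it, print's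
proof does not argue it). [cite: MochizukiFrdI2008, Thm. 6.4 (iv) p.115] -/
theorem Thm64iv_arith_compat [IsGalois ℚ F₁] (Ψ : arithFrobenioid F₁ K₁ ≌ arithFrobenioid F₂ K₂) :
    ∃ (ΨBase : FinSubextCat F₁ K₁ ⥤ FinSubextCat F₂ K₂)
      (_ : Ψ.functor ⋙ (arithFrobenioidOps F₂ K₂).base ≅ (arithFrobenioidOps F₁ K₁).base ⋙ ΨBase),
      ΨBase.IsEquivalence ∧
      ∀ X : FinSubextCat F₁ K₁, IsGalois ℚ X.L →
        ∃ (e : X.L ≃+* (ΨBase.obj X).L) (e₀ : F₁ ≃+* F₂),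
          ∀ a : F₁, e (algebraMap F₁ X.L a) = algebraMap F₂ (ΨBase.obj X).L (e₀ a) := by
  obtain ⟨ΨBase, η, π, hEq, hnorm, hchar, -⟩ := Thm64iv_arith Ψ
  haveI := hEq
  refine ⟨ΨBase, η, hEq, fun X hX => ?_⟩
  exact Thm64iv_compat_of_transport_of_isGalois_base ΨBase ⟨⊥⟩ (IntermediateField.botEquiv F₁ K₁) (π ⟨⊥⟩)
    (hchar ⟨⊥⟩) (fun w => (hnorm ⟨⊥⟩ w).symm) X hX (π X) (hchar X) (fun w => (hnorm X w).symm)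

end Arith

end Literature.AlgebraicGeometry.Frobenioids

end
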